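import Summits.AnomalousDissipation.AnomalousDissipation.Theorems.BaireTransferRobustLoudUpgradeStubSteadyPersist
import Literature.Analysis.FluidPDE.SteadyNSLatticePersistenceDrift
import Literature.Analysis.FunctionSpaces.TorusTruncationH1
import Literature.Analysis.FunctionSpaces.TorusFourierModes
import Literature.Analysis.FunctionSpaces.TorusTrigPoly
import Literature.Analysis.FunctionSpaces.TorusFourierSynthesis

/-!
# Stub `stub_truncate` of the line `malkin-cone-group-orbits` (crux stmt-AnomalousDissipation-1144, lead c14):
# Fourier truncation puts every classical steady state into the exact-polynomial class of an enlarged stock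

Registered signature (proved here, textually): `theorem stub_truncate : ∀ (S : Finset (Fin 3 → ℤ)) (c : Coeff S) (ν : ℝ) (u₀ …) (p₀ …)
(δ : ℝ), 0 < ν → Torus.IsSteadyNSState ν (force S c) u₀ p₀ → 0 < δ → ∃ S', S ⊆ S' ∧ ∃ (c' e' : Coeff S') u' p',
Torus.IsSteadyNSState ν (force S' c') u' p' ∧ (∀ x, laplacian u' x = force S' e' x) ∧ dist c' (fun k => coeffExt S c k) < δ ∧
h1DistSq u' u₀ < δ`: a classical steady state `u₀` of `NS_ν(f_c)` on `T³` (`ν > 0`, ANY mean) is, for every `δ > 0`, `H¹`-within `δ`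
of an exact trigonometric-polynomial steady state `u'` of `NS_ν(f_{c'})` at the SAME viscosity, for an enlarged stock `S' ⊇ S` and a
coefficient vector `c'` sup-within `δ` of the zero-extension of `c`, and `Δu' = f_{e'}` is itself a force of the family.

Proof (Fourier truncation on the lattice; R. Temam, *Navier–Stokes Equations* (1979), Ch. II §1; J. C. Robinson, J. L. Rodrigo, W. Sadowski,
*The Three-Dimensional Navier–Stokes Equations* (2016), §4.1, Lemma 4.1).  Let `a = 𝓕u₀`, `F = 𝓕f_c`; the lattice steady equations
`ν4π²|k|² a(k) + Π_k N(a,a)(k) = F(k)` hold for every `k` (`SteadyLatticeDrift.fourier_eq_of_isSteadyNSState'`; `N(x,y)(k)` is the convective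
symbol `∑ₘ (2πi x(m)·(k−m)) y(k−m)`, componentwise `ScalarFourier.transportSym`, `Π = Torus.lerayCoeff`).  With `a_N = 𝟙_{B_N} a` and
`F_N(k) = ν4π²|k|² a_N(k) + Π_k N(a_N,a_N)(k)` (conjugate symmetric, transversal, vanishing at `0` and off `B_N ∪ (B_N + B_N)`, §2) the KEY
ESTIMATE (§4) is `sup_k ‖F_N(k) − F(k)‖ ≤ η (4π²ν + 18π(M + A))` once the tail `∑_{k ∉ B_N} (1+|k|²)‖a k‖ ≤ η` (§1; bilinearity and the
pointwise bound `‖N(x,y)(k)‖ ≤ 18π ∑ₘ ‖x m‖ ⟨k−m⟩ ‖y(k−m)‖`).  On the symmetric stock `S' = S ∪ −S ∪ B_N ∪ (B_N + B_N)` the family `D = F_N − F`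
vanishes off `S'`, so `c' = ext c + D|S'` has `𝓕f_{c'} = F + D = F_N` (§3) and `dist(c', ext c) = sup ‖D‖ < δ`; the dictionary
`SteadyLatticeDrift.steadyState_of_fourier'` synthesises the classical steady state `u' = P_N u₀` of `NS_ν(f_{c'})`; `𝓕(Δu') = −4π²|k|² a_N`
is again admissible, whence `Δu' = f_{e'}`; and `P_N u₀ → u₀` in `H¹` (§5).  Pure proof file (no definitions).
-/

-- `Summit.<Summit>.<Problem>` is the tree's mandated summit-side namespace (CONVENTIONS §2); for this
-- single-conjunct summit the two coincide, so the duplicate is deliberate.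
set_option linter.dupNamespace false

noncomputable section

open scoped BigOperators Topology ENNReal NNReal InnerProductSpace ComplexConjugate Pointwise
open Filter Set Function TopologicalSpace MeasureTheory UnitAddTorus

namespace Summit.AnomalousDissipation.AnomalousDissipation.Theorems.RobustLoudUpgrade.Poly.Truncate

open Literature.Analysis.FunctionSpaces Literature.Analysis.FunctionSpaces.Torus Literature.Analysis.FunctionSpaces.EuclideanSpace
open Literature.Analysis.FluidPDE Literature.Analysis.FluidPDE.ScalarFourier Literature.Analysis.FluidPDE.SteadyLattice
open Summit.AnomalousDissipation.AnomalousDissipation.Theses.BaireTransfer Summit.AnomalousDissipation.AnomalousDissipation.Theorems.RobustLoudUpgrade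
open Summit.AnomalousDissipation.AnomalousDissipation.Theorems.RobustLoudUpgrade.SteadyPersist

/-! ## §1 Tails of summable families along the frequency balls -/

/-- **Tails of a summable family along the frequency balls are eventually small**: `∑_{k ∉ B_N} g k < η` for all large `N`. [folklore] -/
theorem eventually_tsum_tail_lt (g : (Fin 3 → ℤ) → ℝ) {η : ℝ} (hη : 0 < η) : ∀ᶠ N : ℕ in atTop, (∑' k, (if k ∈ freqBall N then 0 else g k)) < η := by
  have h := (tendsto_order.1 ((tendsto_tsum_compl_atTop_zero g).comp (tendsto_freqBall_atTop (d := Fin 3)))).2 η hη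
  refine h.mono fun N hN => lt_of_eq_of_lt ?_ hN
  rw [Function.comp_apply, show (∑' x : {x // x ∉ freqBall (d := Fin 3) N}, g x) = ∑' x : ({x | x ∉ freqBall (d := Fin 3) N} : Set (Fin 3 → ℤ)), g x
    from rfl, tsum_subtype]
  refine tsum_congr fun k => ?_
  simp only [Set.indicator_apply, Set.mem_setOf_eq]
  by_cases hk : k ∈ freqBall N
  · rw [if_pos hk, if_neg (not_not.2 hk)]
  · rw [if_neg hk, if_pos hk]

/-- The tail family of a non-negative summable family is summable. [folklore] -/
theorem summable_tail {g : (Fin 3 → ℤ) → ℝ} (hg0 : ∀ k, 0 ≤ g k) (hg : Summable g) (B : Finset (Fin 3 → ℤ)) : Summable fun k => if k ∈ B then 0 else g k :=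
  Summable.of_nonneg_of_le (fun k => by split_ifs; exacts [le_rfl, hg0 k]) (fun k => by split_ifs; exacts [hg0 k, le_rfl]) hg

/-- A single term off `B` is at most the tail sum. [folklore] -/
theorem le_tsum_tail {g : (Fin 3 → ℤ) → ℝ} (hg0 : ∀ k, 0 ≤ g k) (hg : Summable g) (B : Finset (Fin 3 → ℤ)) {k : Fin 3 → ℤ} (hk : k ∉ B) :
    g k ≤ ∑' m, (if m ∈ B then 0 else g m) := by
  have h := (summable_tail hg0 hg B).le_tsum k (fun m _ => by split_ifs; exacts [le_rfl, hg0 m])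
  rwa [if_neg hk] at h

/-- Monotonicity of tail sums. [folklore] -/
theorem tsum_tail_mono {g g' : (Fin 3 → ℤ) → ℝ} (hg0 : ∀ k, 0 ≤ g k) (hle : ∀ k, g k ≤ g' k) (hg' : Summable g') (B : Finset (Fin 3 → ℤ)) :
    (∑' m, (if m ∈ B then 0 else g m)) ≤ ∑' m, (if m ∈ B then 0 else g' m) :=
  Summable.tsum_le_tsum (fun m => by split_ifs; exacts [le_rfl, hle m]) (summable_tail hg0 (Summable.of_nonneg_of_le hg0 hle hg') B)
    (summable_tail (fun k => (hg0 k).trans (hle k)) hg' B)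

/-! ## §2 The convective symbol `N(x,y)(k)`: a real-valued bound, finite support, and the projected steady family -/

variable {x y b Q : (Fin 3 → ℤ) → EuclideanSpace ℂ (Fin 3)}

/-- **Real form of the pointwise bound of the symbol** (`SteadyLattice.enorm_nl_le`): if `∑ₘ ‖x m‖ ≤ A` and `⟨l⟩ ‖y l‖ ≤ M` for all `l`,
then `‖N(x,y)(k)‖ ≤ 18π A M`. [folklore] -/
theorem norm_nl_le (hx : Summable fun m => ‖x m‖) {A M : ℝ} (hA : (∑' m, ‖x m‖) ≤ A) (hM0 : 0 ≤ M) (hM : ∀ l, sobolevWeight 1 l * ‖y l‖ ≤ M) (k : Fin 3 → ℤ) :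
    ‖WithLp.toLp 2 (fun pp : Fin 3 => transportSym (fun jj mm => x mm jj) (fun mm => y mm pp) k)‖ ≤ 18 * Real.pi * A * M := by
  have hA0 : 0 ≤ A := le_trans (tsum_nonneg fun m => norm_nonneg _) hA
  have hxA : (∑' m, ‖x m‖ₑ) ≤ ENNReal.ofReal A := by
    rw [show (∑' m, ‖x m‖ₑ) = ∑' m, ENNReal.ofReal ‖x m‖ from tsum_congr fun m => (ofReal_norm _).symm, ← ENNReal.ofReal_tsum_of_nonneg (fun m => norm_nonneg _) hx]
    exact ENNReal.ofReal_le_ofReal hA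
  have hyM : ∀ l, ENNReal.ofReal (sobolevWeight 1 l) * ‖y l‖ₑ ≤ ENNReal.ofReal M := fun l => by
    rw [← ofReal_norm, ← ENNReal.ofReal_mul (sobolevWeight_pos 1 _).le]
    exact ENNReal.ofReal_le_ofReal (hM _)
  rw [← ENNReal.ofReal_le_ofReal_iff (by positivity), ofReal_norm]
  calc _ ≤ ENNReal.ofReal (18 * Real.pi) * ∑' m, ‖x m‖ₑ * ENNReal.ofReal M := (enorm_nl_le x y k).trans (by gcongr; exact hyM _)
    _ ≤ ENNReal.ofReal (18 * Real.pi) * (ENNReal.ofReal A * ENNReal.ofReal M) := by rw [ENNReal.tsum_mul_right]; gcongr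
    _ = ENNReal.ofReal (18 * Real.pi * A * M) := by
        rw [ENNReal.ofReal_mul (by positivity : (0 : ℝ) ≤ 18 * Real.pi * A), ENNReal.ofReal_mul (by positivity : (0 : ℝ) ≤ 18 * Real.pi), mul_assoc]

/-- **Finite support of the symbol**: if `x` and `y` vanish off the finite set `B`, then `N(x,y)(k) = 0` for `k ∉ B + B`
(every summand `x(m) ⋯ y(k−m)` has `m ∉ B` or `k − m ∉ B`). [folklore] -/
theorem nl_eq_zero_of_not_mem_add {B : Finset (Fin 3 → ℤ)} (hx : ∀ m ∉ B, x m = 0) (hy : ∀ m ∉ B, y m = 0) {k : Fin 3 → ℤ} (hk : k ∉ B + B) :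
    WithLp.toLp 2 (fun pp : Fin 3 => transportSym (fun jj mm => x mm jj) (fun mm => y mm pp) k) = 0 := by
  ext p
  rw [nl_apply, PiLp.zero_apply]
  refine Finset.sum_eq_zero fun j _ => ?_
  have hzero : ∀ m, x m j * (dsym j (k - m) * y (k - m) p) = 0 := fun m => by
    by_cases hm : m ∈ B
    · rw [hy _ (fun h => hk (Finset.mem_add.2 ⟨m, hm, k - m, h, by abel⟩)), PiLp.zero_apply, mul_zero, mul_zero]
    · rw [hx _ hm, PiLp.zero_apply, zero_mul]
  simp only [hzero, tsum_zero]

/-- The projected steady family `k ↦ ν4π²|k|² b(k) + Π_k Q(k)` of conjugate-symmetric families `b`, `Q` (e.g. `Q = N(b,b)`, `nl_neg`) is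
conjugate symmetric (`lerayCoeff_neg_conjVec`). [folklore] -/
theorem isConjSymm_steadyFamily (hbc : IsConjSymm b) (hQ : IsConjSymm Q) (ν : ℝ) :
    IsConjSymm (fun k => (((ν * (4 * Real.pi ^ 2 * freqNormSq k) : ℝ)) : ℂ) • b k + Torus.lerayCoeff k (Q k)) := fun k => by
  dsimp only
  rw [freqNormSq_neg, hbc k, hQ k, lerayCoeff_neg_conjVec, conjVec_add, conjVec_smul, Complex.conj_ofReal]

/-- The projected steady family is transversal (`kdot_smul`, `kdot_lerayCoeff`). [folklore] -/
theorem kdot_steadyFamily (hbt : ∀ m : Fin 3 → ℤ, (∑ jj : Fin 3, ((m jj : ℤ) : ℂ) * b m jj) = 0) (s : ℂ) (k : Fin 3 → ℤ) (v : EuclideanSpace ℂ (Fin 3)) :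
    (∑ jj : Fin 3, ((k jj : ℤ) : ℂ) * (s • b k + Torus.lerayCoeff k v) jj) = 0 := by
  rw [kdot_add, kdot_smul, hbt k, mul_zero, kdot_lerayCoeff, add_zero]

/-- The projected steady family vanishes at the zero mode (`|0|² = 0`, `Π₀ = 0`). [folklore] -/
theorem steadyFamily_zero (ν : ℝ) (v : EuclideanSpace ℂ (Fin 3)) :
    (((ν * (4 * Real.pi ^ 2 * freqNormSq (0 : Fin 3 → ℤ)) : ℝ)) : ℂ) • b 0 + Torus.lerayCoeff (0 : Fin 3 → ℤ) v = 0 := by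
  rw [Torus.lerayCoeff_zero, add_zero, freqNormSq_zero, mul_zero, mul_zero, Complex.ofReal_zero, zero_smul]

/-- A real even symbol times a conjugate-symmetric family is conjugate symmetric. [folklore] -/
theorem isConjSymm_symbol_smul (hbc : IsConjSymm b) {s : (Fin 3 → ℤ) → ℝ} (hs : ∀ k, s (-k) = s k) : IsConjSymm (fun k => ((s k : ℝ) : ℂ) • b k) := fun k => by
  dsimp only
  rw [hs k, hbc k, conjVec_smul, Complex.conj_ofReal]

/-! ## §3 Force families: every admissible finitely supported family is the coefficient family of a force -/

/-- `c ↦ f_c` is additive. [folklore] -/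
theorem force_add (S : Finset (Fin 3 → ℤ)) (e e' : Coeff S) : force S (e + e') = force S e + force S e' := projForce_add e e'

/-- **Enlarging the stock does not change the force**: `f_{ext c} = f_c` for the zero-extension `ext c ∈ P_{S'}` of `c ∈ P_S`, `S ⊆ S'`. [folklore] -/
theorem force_ext_eq {S S' : Finset (Fin 3 → ℤ)} (hSS' : S ⊆ S') (c : Coeff S) : force S' (fun k : ↥S' => coeffExt S c k) = force S c := by
  have hfam : (fun k => Torus.lerayCoeff k (coeffExt S' (fun k : ↥S' => coeffExt S c k) k)) = fun k => Torus.lerayCoeff k (coeffExt S c k) := by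
    funext k
    by_cases hk : k ∈ S'
    · rw [coeffExt_of_mem _ hk]
    · rw [coeffExt_of_not_mem _ hk, coeffExt_of_not_mem _ (fun h => hk (hSS' h))]
  show realTrigPoly S' _ = realTrigPoly S _
  rw [hfam, realTrigPoly_eq_comp, realTrigPoly_eq_comp, trigPoly_subset hSS' (fun k _ hkS => by rw [coeffExt_of_not_mem _ hkS, lerayCoeff_zero_vec])]

variable {S' : Finset (Fin 3 → ℤ)} {G : (Fin 3 → ℤ) → EuclideanSpace ℂ (Fin 3)}

/-- The Leray-projected zero-extension of the restriction `G|S'` of a transversal family vanishing at `0` and off `S'` is `G`. [folklore] -/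
theorem forceFamily_restrict (hGt : ∀ k : Fin 3 → ℤ, (∑ jj : Fin 3, ((k jj : ℤ) : ℂ) * G k jj) = 0) (hG0 : G 0 = 0) (hGS : ∀ k ∉ S', G k = 0) :
    (fun k => Torus.lerayCoeff k (coeffExt S' (fun k : ↥S' => G k) k)) = G := by
  funext k
  by_cases hk : k ∈ S'
  · rw [coeffExt_of_mem _ hk]
    by_cases hk0 : k = 0
    · subst hk0; rw [Torus.lerayCoeff_zero, hG0]
    · exact lerayCoeff_of_kdot_eq_zero hk0 (hGt k)
  · rw [coeffExt_of_not_mem _ hk, lerayCoeff_zero_vec, hGS k hk]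

/-- **Every admissible finitely supported family is the full coefficient family of a force of the stock**: for `S'` symmetric and `G`
conjugate symmetric, transversal, vanishing at `0` and off `S'`, `𝓕(complexify ∘ f_{G|S'})(k) = G(k)` for EVERY `k`. [folklore] -/
theorem mFourierCoeff_force_restrict (hS' : ∀ k ∈ S', -k ∈ S') (hGc : IsConjSymm G) (hGt : ∀ k : Fin 3 → ℤ, (∑ jj : Fin 3, ((k jj : ℤ) : ℂ) * G k jj) = 0)
    (hG0 : G 0 = 0) (hGS : ∀ k ∉ S', G k = 0) (k : Fin 3 → ℤ) : mFourierCoeff (complexify ∘ force S' (fun k : ↥S' => G k)) k = G k := by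
  show mFourierCoeff (complexify ∘ realTrigPoly S' (fun k => Torus.lerayCoeff k (coeffExt S' (fun k : ↥S' => G k) k))) k = G k
  rw [forceFamily_restrict hGt hG0 hGS, mFourierCoeff_realTrigPoly hS' hGc]
  split_ifs with hk
  exacts [rfl, (hGS k hk).symm]

/-- Fourier coefficients of a sum of two forces. [folklore] -/
theorem mFourierCoeff_force_add (S : Finset (Fin 3 → ℤ)) (e e' : Coeff S) (k : Fin 3 → ℤ) :
    mFourierCoeff (complexify ∘ force S (e + e')) k = mFourierCoeff (complexify ∘ force S e) k + mFourierCoeff (complexify ∘ force S e') k := by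
  have h : (complexify ∘ (force S e + force S e') : UnitAddTorus (Fin 3) → EuclideanSpace ℂ (Fin 3)) = (complexify ∘ force S e) + (complexify ∘ force S e') := by
    funext z; simp
  rw [force_add, h, mFourierCoeff_add (isSmooth_force' e).complexify_comp.integrable (isSmooth_force' e').complexify_comp.integrable]

/-- Off `S ∪ −S` the Fourier coefficients of `f_c`, `c ∈ P_S`, vanish. [folklore] -/
theorem mFourierCoeff_force_eq_zero {S : Finset (Fin 3 → ℤ)} (c : Coeff S) {k : Fin 3 → ℤ} (hk : k ∉ S) (hk' : -k ∉ S) : mFourierCoeff (complexify ∘ force S c) k = 0 :=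
  mFourierCoeff_realTrigPoly_eq_zero_of_not_mem _ hk hk'

/-! ## §4 The truncated family and the key estimate of the force defect -/

variable {a aN : (Fin 3 → ℤ) → EuclideanSpace ℂ (Fin 3)} {N : ℕ}

/-- The truncation `a_N = 𝟙_{B_N} a` is dominated by `a`. [folklore] -/
theorem norm_trunc_le (haN : ∀ k, aN k = if k ∈ freqBall N then a k else 0) (k : Fin 3 → ℤ) : ‖aN k‖ ≤ ‖a k‖ := by
  rw [haN k]; split_ifs; exacts [le_rfl, by rw [norm_zero]; exact norm_nonneg _]

/-- The truncation of a rapidly decaying family decays rapidly. [folklore] -/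
theorem rapidDecay_trunc (har : RapidDecay a) (haN : ∀ k, aN k = if k ∈ freqBall N then a k else 0) : RapidDecay aN :=
  har.of_norm_le_mul (C := 1) fun k => by rw [one_mul]; exact norm_trunc_le haN k

/-- `⟨l⟩ ≤ 1 + |l|²` (since `⟨l⟩² = 1 + |l|²` and `⟨l⟩ ≥ 1`). [folklore] -/
theorem sobolevWeight_one_le_one_add (l : Fin 3 → ℤ) : sobolevWeight 1 l ≤ 1 + freqNormSq l := by
  nlinarith [Torus.one_le_sobolevWeight zero_le_one l, Torus.sobolevWeight_one_sq l]

/-- **KEY ESTIMATE (the force defect of the truncation is uniformly small).** With `a_N = 𝟙_{B_N} a`, `F_N(k) = ν4π²|k|² a_N(k) + Π_k N(a_N,a_N)(k)`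
and `F(k) = ν4π²|k|² a(k) + Π_k N(a,a)(k)`: if `∑_{k ∉ B_N} (1+|k|²)‖a k‖ ≤ η` then `‖F_N(k) − F(k)‖ ≤ η (4π²ν + 18π (M + A))` for every `k`
(`M = ∑ (1+|m|²)‖a m‖`, `A = ∑ ‖a m‖`): the Stokes piece is the tail term `ν4π²|k|²‖a k‖ ≤ 4π²ν η` (`k ∉ B_N`), and with `b = a_N − a`
(`ℓ¹` norm `≤ η`, weighted sup `≤ η`) bilinearity gives `N(a_N,a_N) − N(a,a) = N(b, a_N) + N(a, b)`, each `≤ 18π η M`, `18π A η` (`norm_nl_le`). [folklore] -/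
theorem norm_defect_le (har : RapidDecay a) (haN : ∀ k, aN k = if k ∈ freqBall N then a k else 0) {ν η : ℝ} (hν : 0 ≤ ν) (hη : 0 ≤ η)
    (htail : (∑' k, (if k ∈ freqBall N then 0 else (1 + freqNormSq k) * ‖a k‖)) ≤ η) (k : Fin 3 → ℤ) :
    ‖((((ν * (4 * Real.pi ^ 2 * freqNormSq k) : ℝ)) : ℂ) • aN k +
          Torus.lerayCoeff k (WithLp.toLp 2 (fun pp : Fin 3 => transportSym (fun jj mm => aN mm jj) (fun mm => aN mm pp) k))) -
        ((((ν * (4 * Real.pi ^ 2 * freqNormSq k) : ℝ)) : ℂ) • a k +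
          Torus.lerayCoeff k (WithLp.toLp 2 (fun pp : Fin 3 => transportSym (fun jj mm => a mm jj) (fun mm => a mm pp) k)))‖ ≤
      η * (4 * Real.pi ^ 2 * ν + 18 * Real.pi * ((∑' m, (1 + freqNormSq m) ^ 1 * ‖a m‖) + ∑' m, ‖a m‖)) := by
  obtain ⟨M, hM⟩ : ∃ M, (∑' m, (1 + freqNormSq m) ^ 1 * ‖a m‖) = M := ⟨_, rfl⟩
  obtain ⟨A, hA⟩ : ∃ A, (∑' m, ‖a m‖) = A := ⟨_, rfl⟩
  rw [hM, hA]
  have haNr : RapidDecay aN := rapidDecay_trunc har haN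
  -- the weight function `g m = (1 + |m|²) ‖a m‖`, its tail, and the constants
  have hg0 : ∀ m : Fin 3 → ℤ, 0 ≤ (1 + freqNormSq m) * ‖a m‖ := fun m => mul_nonneg (zero_le_one.trans (one_le_one_add_freqNormSq m)) (norm_nonneg _)
  have hgs : Summable fun m : Fin 3 → ℤ => (1 + freqNormSq m) * ‖a m‖ := by simpa only [pow_one] using har 1
  have hag : ∀ m : Fin 3 → ℤ, ‖a m‖ ≤ (1 + freqNormSq m) * ‖a m‖ := fun m => le_mul_of_one_le_left (norm_nonneg _) (one_le_one_add_freqNormSq m)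
  have hgη : ∀ m ∉ freqBall N, (1 + freqNormSq m) * ‖a m‖ ≤ η := fun m hm => (le_tsum_tail hg0 hgs _ hm).trans htail
  have hM0 : 0 ≤ M := hM ▸ tsum_nonneg fun m => mul_nonneg (one_add_freqNormSq_pow_nonneg m 1) (norm_nonneg _)
  have hwaN : ∀ l, sobolevWeight 1 l * ‖aN l‖ ≤ M := fun l =>
    (mul_le_mul_of_nonneg_left (norm_trunc_le haN l) (sobolevWeight_pos 1 l).le).trans (hM ▸ weight_mul_norm_le_of_rapidDecay har l)
  -- the truncation error `b = a_N − a`: substitute `a_N = b + a`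
  obtain ⟨b, rfl⟩ : ∃ b, aN = b + a := ⟨aN - a, (sub_add_cancel aN a).symm⟩
  have hbn : ∀ m, ‖b m‖ = if m ∈ freqBall N then 0 else ‖a m‖ := fun m => by
    rw [eq_sub_of_add_eq (haN m)]; split_ifs; exacts [by rw [sub_self, norm_zero], by rw [zero_sub, norm_neg]]
  have hbr : RapidDecay b := har.of_norm_le_mul (C := 1) fun k => by rw [one_mul, hbn k]; split_ifs; exacts [norm_nonneg _, le_rfl]
  have hwb : ∀ l, sobolevWeight 1 l * ‖b l‖ ≤ η := fun l => by
    rw [hbn l]; split_ifs with hl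
    exacts [by rw [mul_zero]; exact hη, (mul_le_mul_of_nonneg_right (sobolevWeight_one_le_one_add l) (norm_nonneg _)).trans (hgη l hl)]
  have hbA : (∑' m, ‖b m‖) ≤ η :=
    calc (∑' m, ‖b m‖) = ∑' m, (if m ∈ freqBall N then 0 else ‖a m‖) := tsum_congr hbn
      _ ≤ ∑' m, (if m ∈ freqBall N then 0 else (1 + freqNormSq m) * ‖a m‖) := tsum_tail_mono (fun m => norm_nonneg _) hag hgs _
      _ ≤ η := htail
  -- the two convective pieces `N(b, b + a)`, `N(a, b)` and the Stokes tail piece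
  have hn1 := norm_nl_le hbr.summable_norm hbA hM0 hwaN k
  have hn2 := norm_nl_le har.summable_norm hA.le hη hwb k
  have hcν0 : 0 ≤ ν * (4 * Real.pi ^ 2 * freqNormSq k) := mul_nonneg hν (mul_nonneg (by positivity) (freqNormSq_nonneg k))
  have hs : ‖(((ν * (4 * Real.pi ^ 2 * freqNormSq k) : ℝ)) : ℂ) • b k‖ ≤ 4 * Real.pi ^ 2 * ν * η := by
    rw [norm_smul, Complex.norm_real, Real.norm_of_nonneg hcν0, hbn k]
    split_ifs with hk
    · rw [mul_zero]; positivity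
    · calc ν * (4 * Real.pi ^ 2 * freqNormSq k) * ‖a k‖ ≤ 4 * Real.pi ^ 2 * ν * ((1 + freqNormSq k) * ‖a k‖) := by nlinarith [mul_nonneg (mul_nonneg hν (sq_nonneg Real.pi)) (norm_nonneg (a k))]
        _ ≤ 4 * Real.pi ^ 2 * ν * η := by gcongr; exact hgη k hk
  -- bilinearity and assembly
  rw [nl_add_left b a (b + a) k (fun j p => summable_nl_rapid hbr haNr k j p) (fun j p => summable_nl_rapid har haNr k j p),
    nl_add_right a b a k (fun j p => summable_nl_rapid har hbr k j p) (fun j p => summable_nl_rapid har har k j p), lerayCoeff_add', lerayCoeff_add',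
    show (b + a) k = b k + a k from rfl, smul_add, show ∀ p q r s t : EuclideanSpace ℂ (Fin 3), p + q + (r + (s + t)) - (q + t) = p + (r + s) from fun p q r s t => by abel]
  refine (norm_add_le _ _).trans ((add_le_add hs ((norm_add_le _ _).trans (add_le_add ((norm_lerayCoeff_le k _).trans hn1) ((norm_lerayCoeff_le k _).trans hn2)))).trans_eq ?_)
  ring

/-! ## §5 `P_N u → u` in `H¹` -/

-- adapted from Literature/Analysis/FluidPDE/KantorovichTransportInequality.lean (`tendsto_integral_norm_fourierTruncate_sub_sq`), on `T³`
/-- `∫ ‖P_N u − u‖² → 0` as a real integral, for `u ∈ L²` (Parseval tail; Robinson–Rodrigo–Sadowski 2016, Lemma 4.1). [folklore] -/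
theorem tendsto_integral_norm_sq_fourierTruncate_sub {u : UnitAddTorus (Fin 3) → EuclideanSpace ℝ (Fin 3)} (hu : MemLp u 2 volume) :
    Tendsto (fun N => ∫ x, ‖fourierTruncate N u x - u x‖ ^ 2) atTop (𝓝 0) := by
  have h2 := (ENNReal.tendsto_toReal ENNReal.zero_ne_top).comp (tendsto_lintegral_enorm_sq_fourierTruncate_sub hu)
  rw [ENNReal.toReal_zero] at h2
  refine h2.congr fun N => ?_
  have hm : AEStronglyMeasurable (fun x => fourierTruncate N u x - u x) volume := (continuous_fourierTruncate N u).aestronglyMeasurable.sub hu.1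
  have hm2 : AEStronglyMeasurable (fun x => ‖fourierTruncate N u x - u x‖ ^ 2) volume := (hm.norm.aemeasurable.pow_const 2).aestronglyMeasurable
  rw [Function.comp_apply, integral_eq_lintegral_of_nonneg_ae (Eventually.of_forall fun x => sq_nonneg _) hm2]
  exact congrArg ENNReal.toReal (lintegral_congr fun x => by rw [ENNReal.ofReal_pow (norm_nonneg _), ofReal_norm])

/-- **`P_N u → u` in `H¹`** for smooth `u`: the squared `H¹` distance `∫‖P_N u − u‖² + ‖∇(P_N u − u)‖₂²` is eventually `< δ`
(`Torus.tendsto_gradNormSq_fourierTruncate_sub` and the `L²` tail). [folklore] -/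
theorem eventually_h1_fourierTruncate_sub_lt {u : UnitAddTorus (Fin 3) → EuclideanSpace ℝ (Fin 3)} (hu : IsSmooth u) {δ : ℝ} (hδ : 0 < δ) :
    ∀ᶠ N : ℕ in atTop, (∫ x, ‖fourierTruncate N u x - u x‖ ^ 2) + gradNormSq (fourierTruncate N u - u) < δ := by
  have h := (tendsto_integral_norm_sq_fourierTruncate_sub (hu.memLp 2)).add (tendsto_gradNormSq_fourierTruncate_sub hu)
  rw [add_zero] at h
  exact (tendsto_order.1 h).2 δ hδ

/-! ## §6 The registered stub -/

/-- **Stub `stub_truncate` of the line `malkin-cone-group-orbits`** (Fourier truncation puts every classical steady state into the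
exact-polynomial class of an enlarged stock): a classical steady state `u₀` (any mean) of `NS_ν(f_c)`, `c ∈ P_S`, `ν > 0`, is, for every
`δ > 0`, `H¹`-within `δ` of an exact trigonometric-polynomial steady state `u'` of `NS_ν(f_{c'})` at the same viscosity, for a stock
`S' ⊇ S` and a coefficient vector `c'` within `δ` of the zero-extension of `c`, with `Δu' = f_{e'}` (`u' = P_N u₀`, `c' = ext c + (F_N − F)|S'`,
`e' = (−4π²|k|² a_N)|S'`; §1–§5 and the dictionary `SteadyLatticeDrift.fourier_eq_of_isSteadyNSState'` / `steadyState_of_fourier'`). [folklore] -/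
theorem stub_truncate :
    ∀ (S : Finset (Fin 3 → ℤ)) (c : Coeff S) (ν : ℝ) (u₀ : UnitAddTorus (Fin 3) → EuclideanSpace ℝ (Fin 3))
      (p₀ : UnitAddTorus (Fin 3) → ℝ) (δ : ℝ), 0 < ν → Torus.IsSteadyNSState ν (force S c) u₀ p₀ → 0 < δ →
      ∃ S' : Finset (Fin 3 → ℤ), S ⊆ S' ∧ ∃ (c' e' : Coeff S') (u' : UnitAddTorus (Fin 3) → EuclideanSpace ℝ (Fin 3))
        (p' : UnitAddTorus (Fin 3) → ℝ), Torus.IsSteadyNSState ν (force S' c') u' p' ∧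
          (∀ x, laplacian u' x = force S' e' x) ∧ dist c' (fun k => coeffExt S c k) < δ ∧ h1DistSq u' u₀ < δ := by
  intro S c ν u₀ p₀ δ hν hst hδ
  classical
  -- §1 the unperturbed state and its force on the lattice
  have hu₀ : IsSmooth u₀ := hst.smooth_velocity.isSmooth_slice (Set.mem_univ 0)
  have hdiv₀ : IsDivFree u₀ := hst.divFree 0 (Set.mem_univ 0)
  obtain ⟨a, ha⟩ : ∃ a, mFourierCoeff (complexify ∘ u₀) = a := ⟨_, rfl⟩
  have har : RapidDecay a := ha ▸ hu₀.complexify_comp.rapidDecay_mFourierCoeff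
  have hat := hdiv₀.sum_mul_mFourierCoeff_eq_zero hu₀
  have hacs : IsConjSymm a := by rw [← ha]; exact isConjSymm_mFourierCoeff hu₀.integrable
  obtain ⟨F, hF⟩ : ∃ F, mFourierCoeff (complexify ∘ force S c) = F := ⟨_, rfl⟩
  have hFc : IsConjSymm F := by rw [← hF]; exact isConjSymm_mFourierCoeff (isSmooth_force' c).integrable
  have hFt := (isDivFree_force' c).sum_mul_mFourierCoeff_eq_zero (isSmooth_force' c)
  rw [ha] at hat; rw [hF] at hFt
  have hF0 : F 0 = 0 := hF ▸ mFourierCoeff_complexify_zero_of_hasZeroMean (isSmooth_force' c) (hasZeroMean_force' c)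
  have hFS : ∀ k : Fin 3 → ℤ, k ∉ S → -k ∉ S → F k = 0 := fun k hk hk' => hF ▸ mFourierCoeff_force_eq_zero c hk hk'
  have heq₀ : ∀ k : Fin 3 → ℤ, (((ν * (4 * Real.pi ^ 2 * freqNormSq k) : ℝ)) : ℂ) • a k +
      Torus.lerayCoeff k (WithLp.toLp 2 (fun pp : Fin 3 => transportSym (fun jj mm => a mm jj) (fun mm => a mm pp) k)) = F k := fun k => by
    have h := SteadyLatticeDrift.fourier_eq_of_isSteadyNSState' hst (isSmooth_force' c) k
    rwa [lerayCoeff_forceCoeff, ha, hF] at h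
  -- §2 the constants, the tolerance `η`, and the choice of `N`
  obtain ⟨M, hM⟩ : ∃ M, (∑' m, (1 + freqNormSq m) ^ 1 * ‖a m‖) = M := ⟨_, rfl⟩
  obtain ⟨A, hA⟩ : ∃ A, (∑' m, ‖a m‖) = A := ⟨_, rfl⟩
  have hM0 : 0 ≤ M := hM ▸ tsum_nonneg fun m => mul_nonneg (one_add_freqNormSq_pow_nonneg m 1) (norm_nonneg _)
  have hA0 : 0 ≤ A := hA ▸ tsum_nonneg fun m => norm_nonneg _
  obtain ⟨K, hK⟩ : ∃ K : ℝ, K = 4 * Real.pi ^ 2 * ν + 18 * Real.pi * (M + A) := ⟨_, rfl⟩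
  have hK0 : 0 ≤ K := by rw [hK]; positivity
  obtain ⟨η, hη⟩ : ∃ η : ℝ, η = δ / (2 * (K + 1)) := ⟨_, rfl⟩
  have hη0 : 0 < η := by rw [hη]; positivity
  have hηK : η * K < δ := by
    have h2 : η * (K + 1) = δ / 2 := by rw [hη]; field_simp
    nlinarith
  obtain ⟨N, htail, hh1⟩ := ((eventually_tsum_tail_lt (fun k => (1 + freqNormSq k) * ‖a k‖) hη0).and (eventually_h1_fourierTruncate_sub_lt hu₀ hδ)).exists
  -- §3 the truncated family `a_N`, its steady family `F_N`, and the defect family `D = F_N − F`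
  obtain ⟨aN, haNdef⟩ : ∃ aN : (Fin 3 → ℤ) → EuclideanSpace ℂ (Fin 3), aN = fun k => if k ∈ freqBall N then a k else 0 := ⟨_, rfl⟩
  have haN : ∀ k, aN k = if k ∈ freqBall N then a k else 0 := fun k => by rw [haNdef]
  have haNr : RapidDecay aN := rapidDecay_trunc har haN
  have haNc : IsConjSymm aN := by rw [haNdef]; exact hacs.indicator neg_mem_freqBall_of_mem
  have haNt : ∀ m : Fin 3 → ℤ, (∑ jj : Fin 3, ((m jj : ℤ) : ℂ) * aN m jj) = 0 := fun m => by rw [haN m]; split_ifs; exacts [hat m, kdot_zero m]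
  have haNS : ∀ m ∉ freqBall N, aN m = 0 := fun m hm => by rw [haN m, if_neg hm]
  obtain ⟨D, hDdef⟩ : ∃ D : (Fin 3 → ℤ) → EuclideanSpace ℂ (Fin 3), D = fun k => ((((ν * (4 * Real.pi ^ 2 * freqNormSq k) : ℝ)) : ℂ) • aN k +
      Torus.lerayCoeff k (WithLp.toLp 2 (fun pp : Fin 3 => transportSym (fun jj mm => aN mm jj) (fun mm => aN mm pp) k))) - F k := ⟨_, rfl⟩
  have hD : ∀ k, D k = ((((ν * (4 * Real.pi ^ 2 * freqNormSq k) : ℝ)) : ℂ) • aN k +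
      Torus.lerayCoeff k (WithLp.toLp 2 (fun pp : Fin 3 => transportSym (fun jj mm => aN mm jj) (fun mm => aN mm pp) k))) - F k := fun k => by rw [hDdef]
  have hDn : ∀ k, ‖D k‖ < δ := fun k => by
    rw [hD k, ← heq₀ k]
    exact lt_of_le_of_lt (norm_defect_le har haN hν.le hη0.le htail.le k) (by rw [hM, hA, ← hK]; exact hηK)
  have hFNc : IsConjSymm (fun k => (((ν * (4 * Real.pi ^ 2 * freqNormSq k) : ℝ)) : ℂ) • aN k +
      Torus.lerayCoeff k (WithLp.toLp 2 (fun pp : Fin 3 => transportSym (fun jj mm => aN mm jj) (fun mm => aN mm pp) k))) :=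
    isConjSymm_steadyFamily haNc (fun k => nl_neg aN aN haNc haNc k) ν
  have hDc : IsConjSymm D := by rw [hDdef]; exact hFNc.sub hFc
  have hD0 : D 0 = 0 := by rw [hD, steadyFamily_zero, hF0, sub_zero]
  -- §4 the enlarged symmetric stock `S' = S ∪ −S ∪ B_N ∪ (B_N + B_N)`
  obtain ⟨S', hS'def⟩ : ∃ S' : Finset (Fin 3 → ℤ), S' = S ∪ S.image (fun k => -k) ∪ (freqBall N ∪ (freqBall N + freqBall N)) := ⟨_, rfl⟩
  have hSS' : S ⊆ S' := fun k hk => by rw [hS'def]; exact Finset.mem_union_left _ (Finset.mem_union_left _ hk)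
  have hS's : ∀ k ∈ S', -k ∈ S' := by
    rw [hS'def]
    intro k hk
    simp only [Finset.mem_union, Finset.mem_image] at hk ⊢
    rcases hk with (hk | ⟨j, hj, rfl⟩) | (hk | hk)
    exacts [Or.inl (Or.inr ⟨k, hk, rfl⟩), Or.inl (Or.inl (by rwa [neg_neg])), Or.inr (Or.inl (neg_mem_freqBall.2 hk)), by
      obtain ⟨y, hy, z, hz, rfl⟩ := Finset.mem_add.1 hk
      exact Or.inr (Or.inr (Finset.mem_add.2 ⟨-y, neg_mem_freqBall.2 hy, -z, neg_mem_freqBall.2 hz, by abel⟩))]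
  have hBS' : ∀ k ∉ S', k ∉ freqBall N := fun k hk h => hk (by rw [hS'def]; exact Finset.mem_union_right _ (Finset.mem_union_left _ h))
  have hBBS' : ∀ k ∉ S', k ∉ freqBall N + freqBall N := fun k hk h => hk (by rw [hS'def]; exact Finset.mem_union_right _ (Finset.mem_union_right _ h))
  have hnSS' : ∀ k ∉ S', -k ∉ S := fun k hk h =>
    hk (by rw [hS'def]; exact Finset.mem_union_left _ (Finset.mem_union_right _ (Finset.mem_image.2 ⟨-k, h, neg_neg k⟩)))
  have hDS : ∀ k ∉ S', D k = 0 := fun k hk => by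
    rw [hD k, haNS k (hBS' k hk), smul_zero, zero_add, nl_eq_zero_of_not_mem_add haNS haNS (hBBS' k hk), lerayCoeff_zero_vec,
      hFS k (fun h => hk (hSS' h)) (hnSS' k hk), sub_zero]
  -- §5 the new coefficient vector `c' = ext c + D|S'` and its force
  obtain ⟨c', hc'⟩ : ∃ c' : Coeff S', c' = (fun k : ↥S' => coeffExt S c k) + (fun k : ↥S' => D k) := ⟨_, rfl⟩
  have hFc' : ∀ k : Fin 3 → ℤ, mFourierCoeff (complexify ∘ force S' c') k = (((ν * (4 * Real.pi ^ 2 * freqNormSq k) : ℝ)) : ℂ) • aN k +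
      Torus.lerayCoeff k (WithLp.toLp 2 (fun pp : Fin 3 => transportSym (fun jj mm => aN mm jj) (fun mm => aN mm pp) k)) := fun k => by
    rw [hc', mFourierCoeff_force_add, force_ext_eq hSS', hF, mFourierCoeff_force_restrict hS's hDc
      (fun k => by rw [hD k, kdot_sub', kdot_steadyFamily haNt, hFt k, sub_zero]) hD0 hDS k, hD k, add_sub_cancel]
  have hdist : dist c' (fun k : ↥S' => coeffExt S c k) < δ := (dist_pi_lt_iff hδ).2 fun k => by
    rw [hc']; dsimp only [Pi.add_apply]; rw [dist_eq_norm, add_sub_cancel_left]; exact hDn k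
  -- §6 the exact polynomial steady state `u' = P_N u₀`
  obtain ⟨u', p', hst', hu', hû'⟩ := SteadyLatticeDrift.steadyState_of_fourier' (isSmooth_force' c') (isDivFree_force' c') (hasZeroMean_force' c')
    haNr haNc haNt (fun k => (hFc' k).symm)
  have hPN : u' = fourierTruncate N u₀ := by
    have h := IsSmooth.ext_mFourierCoeff hu'.complexify_comp (isSmooth_fourierTruncate N u₀).complexify_comp
      (fun k => by rw [hû', mFourierCoeff_fourierTruncate hu₀.integrable, ha, haN k])
    exact funext fun x => complexify_injective (congrFun h x)
  -- §7 the Laplacian of `u'` is a force of the family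
  obtain ⟨L, hLdef⟩ : ∃ L : (Fin 3 → ℤ) → EuclideanSpace ℂ (Fin 3), L = fun k => (((-(4 * Real.pi ^ 2 * freqNormSq k)) : ℝ) : ℂ) • aN k := ⟨_, rfl⟩
  have hL : ∀ k, L k = (((-(4 * Real.pi ^ 2 * freqNormSq k)) : ℝ) : ℂ) • aN k := fun k => by rw [hLdef]
  have hLc : IsConjSymm L := by rw [hLdef]; exact isConjSymm_symbol_smul haNc (fun k => by simp only [freqNormSq_neg])
  have hL0 : L 0 = 0 := by rw [hL, freqNormSq_zero, mul_zero, neg_zero, Complex.ofReal_zero, zero_smul]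
  have hLS : ∀ k ∉ S', L k = 0 := fun k hk => by rw [hL k, haNS k (hBS' k hk), smul_zero]
  have hlap : ∀ x, laplacian u' x = force S' (fun k : ↥S' => L k) x := by
    have h := IsSmooth.ext_mFourierCoeff hu'.laplacian.complexify_comp (isSmooth_force' (S := S') (fun k : ↥S' => L k)).complexify_comp (fun k => by
      rw [mFourierCoeff_complexify_laplacian hu' k, hû', mFourierCoeff_force_restrict hS's hLc (fun k => by rw [hL k, kdot_smul, haNt k, mul_zero])
        hL0 hLS k, hL k, Complex.ofReal_neg, neg_smul])
    exact fun x => complexify_injective (congrFun h x)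
  -- §8 conclusion
  refine ⟨S', hSS', c', fun k => L k, u', p', hst', hlap, hdist, ?_⟩
  rw [hPN]
  exact hh1

end Summit.AnomalousDissipation.AnomalousDissipation.Theorems.RobustLoudUpgrade.Poly.Truncate

end
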